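import Summits.KontsevichZagierPeriods.KontsevichZagierPeriods.Theorems.HurwitzMicroSectorsNormalFormPrincipleAlgSplitK5Kit
import Summits.KontsevichZagierPeriods.KontsevichZagierPeriods.Theorems.AbelContractionRealHyperellipticSectorPortSiegeNfAPoleOneK3

/-!
# Route AbelContraction — `RealHyperellipticSector` (crux stmt-KontsevichZagierPeriods-12475):
# the dimension-certified port, layer 2 — the kit over `K = algebraicClosure ℚ ℝ`

Helper file of the line `Lines/birth.lean` (stub `stub_bakerAlg`, `--supports` the crux): the port
of `Theorems/HurwitzMicroSectorsNormalFormPrincipleAlgSplitK5Kit.lean` (namespace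
`…NormalFormPrinciple.PiBox.AlgSplitK5`) INTO THE BUDGET `KZ.relationsLE 1` — its statements
`… ∈ relations` re-proved with the conclusion `… ∈ relationsLE 1`, each base move carrying the
certificate that its representations have dimension `≤ 1`:

* the **Newton–Leibniz move over the point** with an abstract semialgebraic primitive on `[0,1]`
  (`unit_slab_sub_pt_mem_relationsLE`, registered sub-goal): `[(0,1), F'] ≡ [pt, F(1) − F(0)]`
  (rule 3, `1 → 0`; rule 1a in dimension `1` across the null endpoints);
* the two instances of the affine move carrying a simple pole `[(0,1), c/(x − ρ)]` (`ρ < 0`,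
  resp. `ρ > 1`) to a carrier `[(1, u), ±c/y]` (`pole_neg_sub_carrier_mem_relationsLE`,
  `pole_pos_sub_carrier_mem_relationsLE`).

The affine move with real algebraic coefficients itself, `AlgSplitK5.affineA_sub_mem_relations`,
has the same statement as `SiegeK3.affineA_sub_mem_relations`; inside the budget it is declared
ONCE, as `Port.Dlog.SiegeK3.affineA_sub_mem_relationsLE` (`…PortSiegeNfAPoleOneK3.lean`), and
exported into this namespace (`Port.AlgSplitK5.affineA_sub_mem_relationsLE` names the same
declaration). The dimension-free lemmas of the original (`isAlgebraic_coeK`, `aevalK_coe`,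
`isSemialgebraicFunOn_aevalK(_div)`, `exists_repK_unit`, `peel_pole_algClosure`,
`exists_polynomial_hasDerivAtK`) are reused by importing it.

Sources: M. Kontsevich, D. Zagier, *Periods* (2001), §1.2 rules (1)–(3) [KontsevichZagier2001].
No definitions are introduced.
-/

noncomputable section

open MeasureTheory Set
open scoped Polynomial
open Literature.NumberTheory.Transcendental Literature.NumberTheory.Transcendental.KZ
open Literature.ModelTheory.ExponentialFields (IsSemialgebraic isSemialgebraic_univ)

namespace Summit.KontsevichZagierPeriods.AbelContraction.RealHyperellipticSector.Port

namespace AlgSplitK5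

open Literature.NumberTheory.Transcendental.KZ.BallPeeling (isSemialgebraic_Ioo₁)
open Summit.KontsevichZagierPeriods.HurwitzMicroSectors.NormalFormPrinciple.Negative
  (integrableOn_fin_one)
open Summit.KontsevichZagierPeriods.KontsevichZagierPeriods.BetaCancellationNegative
  (volume_setOf_apply_eq_zero)
open Summit.KontsevichZagierPeriods.HurwitzMicroSectors.NormalFormPrinciple.PiBox.Dlog
  (isSemialgebraic_Icc₁ image_affine_slab_of_pos image_affine_slab_of_neg)

export Dlog.SiegeK3 (affineA_sub_mem_relationsLE)

/-! ## The Newton–Leibniz move over the point on the unit slab inside the budget -/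

/-- **Newton–Leibniz over the point on the unit slab** — rule (3) from dimension `1` to the base
`ℝ⁰`, then rule (1a) in dimension `1` across the two null endpoints (inside the budget
`relationsLE 1`; registered sub-goal of crux stmt-KontsevichZagierPeriods-12475, port of
`PiBox.AlgSplitK5.unit_slab_sub_pt_mem_relations`). Let `N = [(0,1), f]` be an interval
representation whose integrand `x ↦ f(x₀)` is `ℚ`-semialgebraic on the closed slab, and `F` a
primitive of `f` on `(0,1)`, continuous on `[0,1]` and `ℚ`-semialgebraic (read on the first
coordinate) on the closed slab. Then `[N] − [pt, F(1) − F(0)] ∈ KZ.relationsLE 1` for every point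
representation with that constant. [cite: KontsevichZagier2001, §1.2 rule (3)] -/
theorem unit_slab_sub_pt_mem_relationsLE : ∀ (f F : ℝ → ℝ),
    IsSemialgebraicFunOn ℚ {x : Fin 1 → ℝ | x 0 ∈ Set.Icc (0:ℝ) 1} (fun x => F (x 0)) →
    IsSemialgebraicFunOn ℚ {x : Fin 1 → ℝ | x 0 ∈ Set.Icc (0:ℝ) 1} (fun x => f (x 0)) →
    ContinuousOn F (Set.Icc (0:ℝ) 1) → (∀ t ∈ Set.Ioo (0:ℝ) 1, HasDerivAt F (f t) t) →
    ∀ (N : KZ.IntegralRep 1), N.domain = {x | x 0 ∈ Set.Ioo (0:ℝ) 1} →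
    Set.EqOn N.integrand (fun x => f (x 0)) N.domain →
    ∀ (Z : KZ.IntegralRep 0), Z.domain = Set.univ → (Z.integrand = fun _ => F 1 - F 0) →
    KZ.of N - KZ.of Z ∈ KZ.relationsLE 1 := by
  intro f F hF hf hcont hderiv N hNd hNi Z hZd hZi
  -- adapted from `Port.Dlog.slab_sub_pt_mem_relationsLE` (rational primitive) to an abstract primitive
  have hCsa : IsSemialgebraic ℚ {x : Fin 1 → ℝ | x 0 ∈ Set.Icc (0:ℝ) 1} := by
    simpa using isSemialgebraic_Icc₁ 0 1
  have hOsa : IsSemialgebraic ℚ {x : Fin 1 → ℝ | x 0 ∈ Set.Ioo (0:ℝ) 1} := by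
    simpa using isSemialgebraic_Ioo₁ 0 1
  set C : Set (Fin 1 → ℝ) := {x | x 0 ∈ Set.Icc (0:ℝ) 1} with hC
  -- the integrand `f` on the closed slab is integrable (it is `N.integrand` a.e.)
  have hfi : IntegrableOn (fun x : Fin 1 → ℝ => f (x 0)) C := by
    have h1 : IntegrableOn (fun x : Fin 1 → ℝ => f (x 0)) N.domain :=
      N.integrableOn.congr_fun hNi (IsSemialgebraic.measurableSet_holds N.isSemialgebraic_domain)
    rw [hNd, integrableOn_fin_one] at h1
    rw [hC, integrableOn_fin_one]
    exact h1.congr_set_ae (Ioo_ae_eq_Icc (a := (0:ℝ)) (b := 1)).symm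
  -- the closed-slab representation `R = [[0,1], f]`
  obtain ⟨R, hRd, hRi⟩ : ∃ R : IntegralRep 1, R.domain = C ∧ R.integrand = fun x => f (x 0) :=
    ⟨⟨C, fun x => f (x 0), hCsa, hf, hfi⟩, rfl, rfl⟩
  have hs0 : ∀ (x : Fin 0 → ℝ) (t : ℝ), (Fin.snoc x t : Fin 1 → ℝ) 0 = t := fun _ _ => rfl
  -- (i) ONE Newton–Leibniz move `1 → 0` over `ℝ⁰`: `[R] − [Z] ∈ relationsLE 1`, primitive `F (z 0)`
  have hNL : of R - of Z ∈ relationsLE 1 := by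
    refine Budget.newtonLeibniz_mem_relationsLE le_rfl (fun _ => (0:ℝ)) (fun _ => (1:ℝ))
      (fun z => F (z 0)) ?_ ?_ ?_ (fun _ _ => zero_le_one) ?_ ?_ ?_ ?_
    · rw [hRd]; exact hF
    · rw [hZd]
      simpa using isSemialgebraicFunOn_aeval (isSemialgebraic_univ (k := ℚ) (ι := Fin 0) (R := ℝ))
        (MvPolynomial.C 0)
    · rw [hZd]
      simpa using isSemialgebraicFunOn_aeval (isSemialgebraic_univ (k := ℚ) (ι := Fin 0) (R := ℝ))
        (MvPolynomial.C 1)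
    · rw [hRd, hZd, hC]
      ext z
      simp only [Set.mem_setOf_eq, Set.mem_Icc, Set.mem_univ, true_and]
      rfl
    · intro x _
      simp only [hs0]
      exact hcont
    · intro x _ t ht
      rw [hRi]
      simp only [hs0]
      exact hderiv t ht
    · intro x _
      simp only [hZi, hs0]
  -- (ii) closed slab versus the open slab `N.domain` (null endpoints), and congruence with `N`
  have hEsub : {x : Fin 1 → ℝ | x 0 ∈ Set.Ioo (0:ℝ) 1} ⊆ R.domain := by
    rw [hRd, hC]
    exact fun x hx => Set.Ioo_subset_Icc_self hx
  have hnull : volume (R.domain \ {x : Fin 1 → ℝ | x 0 ∈ Set.Ioo (0:ℝ) 1}) = 0 := by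
    refine measure_mono_null (fun x hx => ?_)
      (measure_union_null (volume_setOf_apply_eq_zero (0 : Fin 1) (0:ℝ))
        (volume_setOf_apply_eq_zero (0 : Fin 1) (1:ℝ)))
    rw [hRd, hC] at hx
    obtain ⟨⟨h1, h2⟩, h3⟩ := hx
    simp only [Set.mem_setOf_eq, Set.mem_Ioo, not_and, not_lt] at h3
    simp only [Set.mem_union, Set.mem_setOf_eq]
    rcases h1.lt_or_eq with h1 | h1
    · exact Or.inr (le_antisymm h2 (h3 h1))
    · exact Or.inl h1.symm
  have h2 : of R - of (R.restrict _ hOsa hEsub) ∈ relationsLE 1 :=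
    Budget.of_sub_of_restrict_mem_relationsLE le_rfl R hOsa hEsub hnull
  have h3 : of (R.restrict _ hOsa hEsub) - of N ∈ relationsLE 1 :=
    Budget.congr_mem_relationsLE le_rfl (by rw [hNd]; rfl) fun x hx => by
      rw [IntegralRep.integrand_restrict, hRi, hNi (by rw [hNd]; exact hx)]
  have : of N - of Z = (of R - of Z) - (of R - of (R.restrict _ hOsa hEsub)) -
      (of (R.restrict _ hOsa hEsub) - of N) := by abel
  rw [this]
  exact (relationsLE 1).sub_mem ((relationsLE 1).sub_mem hNL h2) h3

/-! ## Simple poles to carriers inside the budget -/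

/-- **A simple pole to the left of `[0,1]` is a carrier** (inside the budget `relationsLE 1`): for
real algebraic `ρ < 0` and algebraic `c`, the substitution `y = (x − ρ)/(−ρ)` carries
`[(0,1), c/(x − ρ)]` to `[(1, 1 − 1/ρ), c/y]` (one rule-(2) move among representations of dimension
`1`). [cite: KontsevichZagier2001, §1.2 rule (2)] -/
theorem pole_neg_sub_carrier_mem_relationsLE {ρ c : ℝ} (hρalg : IsAlgebraic ℚ ρ) (hρ : ρ < 0)
    (N L : IntegralRep 1) (hNd : N.domain = {x | x 0 ∈ Set.Ioo (0:ℝ) 1})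
    (hNi : EqOn N.integrand (fun x => c / (x 0 - ρ)) N.domain)
    (hLd : L.domain = {x | x 0 ∈ Set.Ioo (1:ℝ) (1 - 1 / ρ)})
    (hLi : L.integrand = fun x => c / x 0) : of N - of L ∈ relationsLE 1 := by
  have hs : 0 < -1 / ρ := div_pos_of_neg_of_neg (by norm_num) hρ
  refine affineA_sub_mem_relationsLE (s := -1 / ρ) (t := 1)
    (by rw [neg_div, one_div]; exact hρalg.inv.neg)
    isAlgebraic_one hs.ne' N L (fun y => c / y) ?_ (by rw [hLi]; exact fun _ _ => rfl) fun x hx => ?_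
  · rw [hNd, image_affine_slab_of_pos hs, hLd]
    congr 1
    ext x
    have : -1 / ρ * 1 + 1 = 1 - 1 / ρ := by ring
    rw [mul_zero, zero_add, this]
  · rw [hNi hx, abs_of_pos hs]
    have hx0 : x 0 - ρ ≠ 0 := by rw [hNd] at hx; linarith [hx.1]
    have hρ0 : ρ ≠ 0 := hρ.ne
    have hΦ : -1 / ρ * x 0 + 1 = (x 0 - ρ) * (-1 / ρ) := by field_simp; ring
    show c / (x 0 - ρ) = c / (-1 / ρ * x 0 + 1) * (-1 / ρ)
    rw [hΦ, div_mul_eq_div_div, div_mul_cancel₀ _ hs.ne']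

/-- **A simple pole to the right of `[0,1]` is a carrier** (inside the budget `relationsLE 1`):
for real algebraic `ρ > 1` and algebraic `c`, the (orientation-reversing) substitution
`y = (x − ρ)/(1 − ρ)` carries `[(0,1), c/(x − ρ)]` to `[(1, ρ/(ρ − 1)), (−c)/y]` (one rule-(2)
move among representations of dimension `1`). [cite: KontsevichZagier2001, §1.2 rule (2)] -/
theorem pole_pos_sub_carrier_mem_relationsLE {ρ c : ℝ} (hρalg : IsAlgebraic ℚ ρ) (hρ : 1 < ρ)
    (N L : IntegralRep 1) (hNd : N.domain = {x | x 0 ∈ Set.Ioo (0:ℝ) 1})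
    (hNi : EqOn N.integrand (fun x => c / (x 0 - ρ)) N.domain)
    (hLd : L.domain = {x | x 0 ∈ Set.Ioo (1:ℝ) (ρ / (ρ - 1))})
    (hLi : L.integrand = fun x => (-c) / x 0) : of N - of L ∈ relationsLE 1 := by
  have hρ1 : ρ - 1 ≠ 0 := by linarith
  have hρ1' : 1 - ρ ≠ 0 := by linarith
  have hs : 1 / (1 - ρ) < 0 := div_neg_of_pos_of_neg one_pos (by linarith)
  refine affineA_sub_mem_relationsLE (s := 1 / (1 - ρ)) (t := -ρ / (1 - ρ))
    (by rw [one_div]; exact (isAlgebraic_one.sub hρalg).inv)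
    (by rw [neg_div, div_eq_mul_inv]; exact (hρalg.mul (isAlgebraic_one.sub hρalg).inv).neg) hs.ne N L
    (fun y => (-c) / y) ?_ (by rw [hLi]; exact fun _ _ => rfl) fun x hx => ?_
  · rw [hNd, image_affine_slab_of_neg hs, hLd]
    congr 1
    ext x
    have h1 : 1 / (1 - ρ) * 1 + -ρ / (1 - ρ) = 1 := by field_simp; ring
    have h2 : 1 / (1 - ρ) * 0 + -ρ / (1 - ρ) = ρ / (ρ - 1) := by
      rw [mul_zero, zero_add, neg_div, ← div_neg, neg_sub]
    rw [h1, h2]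
  · rw [hNi hx, abs_of_neg hs]
    have hx0 : x 0 - ρ ≠ 0 := by rw [hNd] at hx; linarith [hx.2]
    have hΦ : 1 / (1 - ρ) * x 0 + -ρ / (1 - ρ) = (x 0 - ρ) * (1 / (1 - ρ)) := by field_simp; ring
    show c / (x 0 - ρ) = (-c) / (1 / (1 - ρ) * x 0 + -ρ / (1 - ρ)) * -(1 / (1 - ρ))
    rw [hΦ, div_mul_eq_div_div, neg_div, mul_neg, neg_div, neg_mul, neg_neg, div_mul_cancel₀ _ hs.ne]

end AlgSplitK5

end Summit.KontsevichZagierPeriods.AbelContraction.RealHyperellipticSector.Port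

end
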